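import Literature.Algebra.Homology.ExtOfProjectiveResolutionPrecomp
import Literature.Algebra.Homology.ModuleResolutionComparison
import HarnessLib

/-!
# `Extⁿ⁺¹_R(M, N) ≃ₗ[R] Hⁿ⁺¹(Hom_R(L•, N))` is natural in the resolved module `M`: the Comparison
# Theorem's `f̃^*` is `Ext(f', N)`, and the explicit comparison of two resolutions is the `Ext`-route one

Topic `Algebra/Homology`; namespace `Literature.Algebra.Homology.ModuleResolution`.  Definitions with bodies (one
piece of plumbing: the chain map of `ModuleCat R` attached to a family of linear maps) and theorems; imports the
sibling `ExtOfProjectiveResolutionPrecomp` (lit-6 g8 H1: naturality of the categorical engine in the resolved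
variable), the tree's `ModuleResolutionComparison` (lit-6 g5: Comparison Theorem 2.2.6 in linear-map form,
`homHComap`, `lift`, `homHComapOfMap`, `homHEquivOfResolutions`) — hence `ExtOfProjectiveResolutionLinearMap`
(`extAddEquivHomH`, `extLinearEquivHomH`, `homHLinearEquivOfResolutions`) — and Mathlib; no named fact (net debt 0),
no instance, no notation, no `sorry`.

The tree identifies, for a resolution `⋯ → L₁ → L₀ —ε→ M → 0` by projective `R`-modules given by LINEAR MAPS,
Mathlib's `Extⁿ⁺¹_R(M, N)` with the concrete `Hⁿ⁺¹(Hom_R(L•, N)) = HomH d N (n + 1)`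
(`ModuleResolution.extAddEquivHomH ∕ extLinearEquivHomH`, natural in `N`), and separately constructs, for
`f' : M → M'` and resolutions `L• → M`, `K• → M'`, a lift `f• : L• → K•` (`ModuleResolution.lift`, Weibel Comparison
Theorem 2.2.6) with its induced `f^* = homHComap N f hf : Hⁿ(Hom_R(K•, N)) → Hⁿ(Hom_R(L•, N))`, canonical in `f'`
(`homHComapOfMap`), and for two projective resolutions of one `M` the explicit comparison `homHEquivOfResolutions`.
That these two constructions AGREE — i.e. that `extLinearEquivHomH` is natural in `M`, the docstring TODO of
`ModuleResolutionComparison` («that they AGREE […] is NOT proved here») and Mathlib's TODO «functoriality in `X`» — is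
proved here, by transporting the sibling's categorical statement along the presentation
`Hⁿ⁺¹(Ext⁰(L•, N)) ≃+ HomH d N (n + 1)`:

* §1 `complexMap f hf : complex L d hd ⟶ complex K δ hδ` — the chain map of `ModuleCat R` with components
  `ofHom (fᵢ)` (`ChainComplex.ofHom`); `complexMap_f`, `complexMap_f_zero_comp_aug` (over `f'`:
  `f₀ ≫ η = ε ≫ f'` from `η ∘ f₀ = f' ∘ ε`).
* §2 `extZeroAddEquiv_mk₀_comp`, **`homologyAddEquivHomH_precomp`**: the presentation intertwines
  `Hⁿ⁺¹((complexMap f)^*)` (the sibling's `LeftResolution.homComplexPrecomp`) with `homHComap N f hf (n + 1)`.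
* §3 **`extAddEquivHomH_precomp`** ∕ **`extLinearEquivHomH_precomp`**:
  `E_L([f'] ∘ x') = homHComap N f hf (n+1) (E_K x')` for every chain map `f•` over `f'` between projective
  resolutions `L• → M`, `K• → M'` — [Weibel1994, Lemma 2.4.4, p. 43] «the map `L_iF(f)` is `f̃_*`» for the
  contravariant `F = Hom_R(–, N)` of [Weibel1994, Thm. 2.7.6, p. 58]: the Comparison Theorem's `f̃^*` IS
  `Extⁿ⁺¹(f', N) = (x' ↦ [f'] ∘ x')` (Mathlib `(Ext.mk₀ (ofHom f')).comp`).
* §4 consequences: `extAddEquivHomH_precomp_eq_homHComapOfMap` (the tree's CANONICAL map `homHComapOfMap N … f'`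
  is `E_L ∘ Extⁿ⁺¹(f', N) ∘ E_K⁻¹`: `homHComapOfMap_eq`), `homHComap_extAddEquivHomH_of_lifts_id` (a chain map over
  `𝟙 M` induces `E_L ∘ E_K⁻¹`), and **`homHEquivOfResolutions_eq_homHLinearEquivOfResolutions`**: for two projective
  resolutions of the same `M`, the EXPLICIT comparison `homHEquivOfResolutions` (comap along any lift of `𝟙 M`,
  [Weibel1994, Lemma 2.4.1, p. 42] «the map `f_*` is canonical») EQUALS the `Ext`-route comparison
  `homHLinearEquivOfResolutions = E_K⁻¹ ≫ E_L` of `ExtOfProjectiveResolutionLinearMap`, in every positive degree.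

Written by the literature-typing width seat lit-6 g8 (cell `pub-hsemireg`, tranche LT-H1) for the lit-6 free-list item
«naturality of `extLinearEquivHomH` in `M`» (lit-6 g5 ∕ g6 ∕ g7 hand-offs).  HONEST SCOPE: all modules in ONE universe
`v` with `[Small.{v} R]` (the tree's `extAddEquivHomH` hypotheses; `ModuleResolutionComparison` alone allows `K`, `N`
in other universes); positive degrees `n + 1` only (degree `0` of the engine is lit-6 g7's
`ExtOfProjectiveResolutionDegreeZero`, keyed separately — its naturality in `M` is one line from §2 once landed:
TODO(general form)); compatibility with connecting homomorphisms not here.  Homological algebra only; nothing here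
bears on any summit.  Grade: REFEREED (textbook).

Mathlib ∕ tree searches: Mathlib `ChainComplex.ofHom`, `ProjectiveResolution.lift` (categorical, chosen resolutions;
no statement about `Ext`), tree `ModuleResolution.extAddEquivHomH_naturality` (in `N`), `homHComap_eq_of_lifts`,
`homHEquivOfResolutions_eq_homHComap`, `LeftResolution.extAddEquivHomologySucc_precomp` (sibling).  Nothing restated.

## References
* [Weibel1994] C. A. Weibel, *An introduction to homological algebra*, CUP (1994): Comparison Theorem 2.2.6 (p. 35),
  Lemma 2.4.1 (p. 42), Lemma 2.4.4 (p. 43), Thm. 2.7.6 (p. 58).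
-/

noncomputable section

universe v u

open CategoryTheory CategoryTheory.Limits CategoryTheory.Abelian

namespace Literature.Algebra.Homology

namespace ModuleResolution

variable {R : Type u} [CommRing R]
  {L : ℕ → Type v} [∀ i, AddCommGroup (L i)] [∀ i, Module R (L i)]
  {K : ℕ → Type v} [∀ i, AddCommGroup (K i)] [∀ i, Module R (K i)]
  {d : ∀ i, L (i + 1) →ₗ[R] L i} {δ : ∀ i, K (i + 1) →ₗ[R] K i}

/-! ## §1 The chain map of `ModuleCat R` attached to a family of linear maps -/

section ComplexMap

variable {hd : ∀ i, d i ∘ₗ d (i + 1) = 0} {hδ : ∀ i, δ i ∘ₗ δ (i + 1) = 0}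
  (f : ∀ i, L i →ₗ[R] K i) (hf : ∀ i, δ i ∘ₗ f (i + 1) = f i ∘ₗ d i)

variable (hd hδ) in
/-- **The chain map `f• : L• → K•` in `ModuleCat R`** attached to linear maps `fᵢ : Lᵢ → Kᵢ` with
`δᵢ ∘ fᵢ₊₁ = fᵢ ∘ dᵢ` (Mathlib `ChainComplex.ofHom` on the tree's `complex L d hd`, `complex K δ hδ`) — «a chain
map `f̃` from `P'` to `P`». [cite: Weibel1994, Lemma 2.4.4 (p. 43)] -/
def complexMap : complex L d hd ⟶ complex K δ hδ :=
  ChainComplex.ofHom (fun i => ModuleCat.ofHom (f i)) fun i => by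
    ext x
    change ((complex K δ hδ).d (i + 1) i).hom (f (i + 1) x) = f i (((complex L d hd).d (i + 1) i).hom x)
    rw [complex_d_apply, complex_d_apply]
    exact DFunLike.congr_fun (hf i) x

/-- Components of `complexMap`: `ofHom (fᵢ)`. [cite: Weibel1994, Lemma 2.4.4 (p. 43)] -/
@[simp]
theorem complexMap_f (i : ℕ) : (complexMap hd hδ f hf).f i = ModuleCat.ofHom (f i) := rfl

/-- **`f•` lies over `f'`**: `f₀ ≫ η = ε ≫ f'` in `ModuleCat R` when `η ∘ f₀ = f' ∘ ε` («lifting `f'` in the sense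
that `η ∘ f₀ = f' ∘ ε`»). [cite: Weibel1994, Comparison Theorem 2.2.6 (p. 35)] -/
theorem complexMap_f_zero_comp_aug {M M' : Type v} [AddCommGroup M] [Module R M] [AddCommGroup M']
    [Module R M'] {ε : L 0 →ₗ[R] M} {η : K 0 →ₗ[R] M'} (f' : M →ₗ[R] M') (hf0 : η ∘ₗ f 0 = f' ∘ₗ ε) :
    (complexMap hd hδ f hf).f 0 ≫ aug η = aug ε ≫ ModuleCat.ofHom f' := by
  change ModuleCat.ofHom (f 0) ≫ ModuleCat.ofHom η = ModuleCat.ofHom ε ≫ ModuleCat.ofHom f'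
  rw [← ModuleCat.ofHom_comp, ← ModuleCat.ofHom_comp, hf0]

end ComplexMap

/-! ## §2 The presentation `Hⁿ⁺¹(Ext⁰(L•, N)) ≃+ Hⁿ⁺¹(Hom_R(L•, N))` intertwines `(f•)^*` with `homHComap` -/

section Presentation

variable [Small.{v} R] {hd : ∀ i, d i ∘ₗ d (i + 1) = 0} {hδ : ∀ i, δ i ∘ₗ δ (i + 1) = 0}
  (f : ∀ i, L i →ₗ[R] K i) (hf : ∀ i, δ i ∘ₗ f (i + 1) = f i ∘ₗ d i)
  (N : Type v) [AddCommGroup N] [Module R N]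

/-- `Ext⁰ = Hom` carries `x ↦ [fₙ] ∘ x` to `φ ↦ φ ∘ fₙ`. [cite: Weibel1994, §2.5; Lemma 2.4.4 (p. 43)] -/
theorem extZeroAddEquiv_mk₀_comp (n : ℕ) (x : Ext ((complex K δ hδ).X n) (ModuleCat.of R N) 0) :
    extZeroAddEquiv (hd := hd) N n ((Ext.mk₀ ((complexMap hd hδ f hf).f n)).comp x (zero_add 0)) =
      extZeroAddEquiv N n x ∘ₗ f n := by
  obtain ⟨g, rfl⟩ : ∃ g, x = Ext.mk₀ g := ⟨Ext.addEquiv₀ x, (Ext.mk₀_addEquiv₀_apply x).symm⟩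
  rw [Ext.mk₀_comp_mk₀, extZeroAddEquiv_mk₀, extZeroAddEquiv_mk₀, complexMap_f, ModuleCat.hom_comp]
  rfl

/-- **The presentation step intertwines `Hⁿ⁺¹((f•)^*)` with `homHComap`**:
`homologyAddEquivHomH ∘ Hⁿ⁺¹(Ext⁰(f•, N)) = Hⁿ⁺¹(Hom_R(f•, N)) ∘ homologyAddEquivHomH` (the tree's
`AcyclicResolution.homologyMap_concreteOf` read through `cyclesAddEquiv`; mirror of the tree's
`homologyAddEquivHomH_naturality`). [cite: Weibel1994, Lemma 2.4.4 (p. 43); §2.5 (Example 2.5.3)] -/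
theorem homologyAddEquivHomH_precomp (n : ℕ)
    (z : ((extZeroComplex K δ hδ N).homology (n + 1) : AddCommGrpCat.{v})) :
    homologyAddEquivHomH (hd := hd) N n ((HomologicalComplex.homologyMap
        (LeftResolution.homComplexPrecomp (complexMap hd hδ f hf) (ModuleCat.of R N)) (n + 1)).hom z) =
      homHComap N f hf (n + 1) (homologyAddEquivHomH N n z) := by
  set ψ := LeftResolution.homComplexPrecomp (complexMap hd hδ f hf) (ModuleCat.of R N) with hψ
  set e5 := ((extZeroComplex K δ hδ N).homologyIsoSc' n (n + 1) (n + 1 + 1) (CochainComplex.prev_nat_succ n)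
      (CochainComplex.next ℕ (n + 1)) ≪≫ ((extZeroComplex K δ hδ N).sc' n (n + 1) (n + 1 + 1)).abHomologyIso)
    with he5
  set e5' := ((extZeroComplex L d hd N).homologyIsoSc' n (n + 1) (n + 1 + 1) (CochainComplex.prev_nat_succ n)
      (CochainComplex.next ℕ (n + 1)) ≪≫ ((extZeroComplex L d hd N).sc' n (n + 1) (n + 1 + 1)).abHomologyIso)
    with he5'
  -- write `z` as the class of an explicit cycle `y`
  obtain ⟨y, hy⟩ := QuotientAddGroup.mk_surjective (e5.addCommGroupIsoToAddEquiv z)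
  have hz : z = e5.addCommGroupIsoToAddEquiv.symm (QuotientAddGroup.mk y) := by
    rw [hy, AddEquiv.symm_apply_apply]
  -- the abstract homology map, read through the presentations, is `kerQuotMapOf ψ`
  have hnat := AcyclicResolution.homologyMap_concreteOf ψ n (n + 1) (n + 1 + 1)
    (CochainComplex.prev_nat_succ n) (CochainComplex.next ℕ (n + 1))
  have step : (HomologicalComplex.homologyMap ψ (n + 1)).hom z = e5'.addCommGroupIsoToAddEquiv.symm
      (QuotientAddGroup.mk (AcyclicResolution.kerMapOf ψ n (n + 1) (n + 1 + 1) y)) := by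
    apply e5'.addCommGroupIsoToAddEquiv.injective
    rw [AddEquiv.apply_symm_apply]
    change (HomologicalComplex.homologyMap ψ (n + 1) ≫ e5'.hom).hom z = _
    rw [hnat, hz]
    change AcyclicResolution.kerQuotMapOf ψ n (n + 1) (n + 1 + 1)
      (e5.addCommGroupIsoToAddEquiv (e5.addCommGroupIsoToAddEquiv.symm (QuotientAddGroup.mk y))) = _
    rw [AddEquiv.apply_symm_apply]
    rfl
  rw [step, hz, he5, he5', homologyAddEquivHomH_symm_mk, homologyAddEquivHomH_symm_mk, homHComap_mk]
  congr 1
  apply Subtype.ext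
  rw [cyclesAddEquiv_apply_coe, homCocyclesComap_apply_coe, cyclesAddEquiv_apply_coe,
    AcyclicResolution.kerMapOf_apply_val, hψ, LeftResolution.homComplexPrecomp_f_apply,
    extZeroAddEquiv_mk₀_comp]

end Presentation

/-! ## §3 Naturality of `Extⁿ⁺¹_R(M, N) ≃ Hⁿ⁺¹(Hom_R(L•, N))` in the resolved module -/

section Main

variable [Small.{v} R] [∀ i, Module.Projective R (L i)] [∀ i, Module.Projective R (K i)]
  {M M' : Type v} [AddCommGroup M] [Module R M] [AddCommGroup M'] [Module R M']
  {ε : L 0 →ₗ[R] M} {η : K 0 →ₗ[R] M'} (N : Type v) [AddCommGroup N] [Module R N]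
  (hL : ∀ i, Function.Exact (d (i + 1)) (d i)) (hL₀ : Function.Exact (d 0) ε) (hε : Function.Surjective ε)
  (hK : ∀ i, Function.Exact (δ (i + 1)) (δ i)) (hK₀ : Function.Exact (δ 0) η) (hη : Function.Surjective η)
  (f : ∀ i, L i →ₗ[R] K i) (hf : ∀ i, δ i ∘ₗ f (i + 1) = f i ∘ₗ d i) (f' : M →ₗ[R] M')
  (hf0 : η ∘ₗ f 0 = f' ∘ₗ ε)

include hf0 in
/-- **Naturality of `extAddEquivHomH` in the resolved module**: for projective resolutions `L• —ε→ M`,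
`K• —η→ M'`, a chain map `f• : L• → K•` over `f' : M → M'` (`η ∘ f₀ = f' ∘ ε`, e.g. the tree's `lift`) and every
`x' ∈ Extⁿ⁺¹_R(M', N)`: `E_L([f'] ∘ x') = Hⁿ⁺¹(Hom_R(f•, N))(E_K x')` — «hence a map `f̃_*` from `H_iF(P')` to
`H_iF(P)` […] The map `L_iF(f)` is `f̃_*`»: the Comparison Theorem's `f̃^*` IS `Extⁿ⁺¹(f', N)`.
[cite: Weibel1994, Lemma 2.4.4 (p. 43); Theorem 2.7.6 (p. 58)] -/
theorem extAddEquivHomH_precomp (n : ℕ) (x' : Ext (ModuleCat.of R M') (ModuleCat.of R N) (n + 1)) :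
    extAddEquivHomH N hL hL₀ hε n ((Ext.mk₀ (ModuleCat.ofHom f')).comp x' (zero_add (n + 1))) =
      homHComap N f hf (n + 1) (extAddEquivHomH N hK hK₀ hη n x') := by
  haveI := epi_aug (hd := fun i => (hL i).linearMap_comp_eq_zero) hε
  haveI := epi_aug (hd := fun i => (hK i).linearMap_comp_eq_zero) hη
  rw [extAddEquivHomH_apply, extAddEquivHomH_apply,
    LeftResolution.extAddEquivHomologySucc_precomp
      (complexMap (fun i => (hL i).linearMap_comp_eq_zero) (fun i => (hK i).linearMap_comp_eq_zero) f hf)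
      (ModuleCat.of R N) (aug ε) (aug η)
      (d_comp_aug hL₀.linearMap_comp_eq_zero) (d_comp_aug hK₀.linearMap_comp_eq_zero)
      (aug_exact hL₀) (aug_exact hK₀) (complex_exactAt_succ hL) (complex_exactAt_succ hK)
      (ext_complex_X_eq_zero (ModuleCat.of R N)) (ext_complex_X_eq_zero (ModuleCat.of R N))
      (ModuleCat.ofHom f') (complexMap_f_zero_comp_aug f hf f' hf0) n x',
    homologyAddEquivHomH_precomp]

include hf0 in
/-- **Naturality of `extLinearEquivHomH` in the resolved module** (the `R`-linear identification of Thm. 2.7.6):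
`E_L([f'] ∘ x') = homHComap N f hf (n+1) (E_K x')`. [cite: Weibel1994, Lemma 2.4.4 (p. 43); Theorem 2.7.6 (p. 58)] -/
theorem extLinearEquivHomH_precomp (n : ℕ) (x' : Ext (ModuleCat.of R M') (ModuleCat.of R N) (n + 1)) :
    extLinearEquivHomH hL hL₀ hε n ((Ext.mk₀ (ModuleCat.ofHom f')).comp x' (zero_add (n + 1))) =
      homHComap N f hf (n + 1) (extLinearEquivHomH hK hK₀ hη n x') :=
  extAddEquivHomH_precomp N hL hL₀ hε hK hK₀ hη f hf f' hf0 n x'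

include hf0 in
/-- Inverse form: `Hⁿ⁺¹(Hom_R(f•, N)) = E_L ∘ Extⁿ⁺¹(f', N) ∘ E_K⁻¹` on `Hⁿ⁺¹(Hom_R(K•, N))`.
[cite: Weibel1994, Lemma 2.4.4 (p. 43); Theorem 2.7.6 (p. 58)] -/
theorem homHComap_eq_extAddEquivHomH_conj (n : ℕ) (y : HomH δ N (n + 1)) :
    homHComap N f hf (n + 1) y =
      extAddEquivHomH N hL hL₀ hε n
        ((Ext.mk₀ (ModuleCat.ofHom f')).comp ((extAddEquivHomH N hK hK₀ hη n).symm y) (zero_add (n + 1))) := by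
  rw [extAddEquivHomH_precomp N hL hL₀ hε hK hK₀ hη f hf f' hf0, AddEquiv.apply_symm_apply]

end Main

/-! ## §4 Consequences: the canonical map `homHComapOfMap`, lifts of `𝟙 M`, and the two comparisons agree -/

section Canonical

variable [Small.{v} R] [∀ i, Module.Projective R (L i)] [∀ i, Module.Projective R (K i)]
  {M M' : Type v} [AddCommGroup M] [Module R M] [AddCommGroup M'] [Module R M']
  {ε : L 0 →ₗ[R] M} {η : K 0 →ₗ[R] M'} (N : Type v) [AddCommGroup N] [Module R N]
  (hL : ∀ i, Function.Exact (d (i + 1)) (d i)) (hL₀ : Function.Exact (d 0) ε) (hε : Function.Surjective ε)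
  (hK : ∀ i, Function.Exact (δ (i + 1)) (δ i)) (hK₀ : Function.Exact (δ 0) η) (hη : Function.Surjective η)
  (f' : M →ₗ[R] M')

/-- **The tree's CANONICAL map `homHComapOfMap N … f'` (comap along the constructed lift of `f'`) is
`Extⁿ⁺¹(f', N)` under the identifications**: `E_L([f'] ∘ x') = homHComapOfMap … f' (n+1) (E_K x')` — «Therefore,
the map `f_*` is canonical», here identified with Yoneda pre-composition.
[cite: Weibel1994, Lemma 2.4.1 (p. 42); Lemma 2.4.4 (p. 43)] -/
theorem extAddEquivHomH_precomp_eq_homHComapOfMap (n : ℕ)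
    (x' : Ext (ModuleCat.of R M') (ModuleCat.of R N) (n + 1)) :
    extAddEquivHomH N hL hL₀ hε n ((Ext.mk₀ (ModuleCat.ofHom f')).comp x' (zero_add (n + 1))) =
      homHComapOfMap N (fun i => (hL i).linearMap_comp_eq_zero) hL₀.linearMap_comp_eq_zero hK hK₀ hη f'
        (n + 1) (extAddEquivHomH N hK hK₀ hη n x') :=
  extAddEquivHomH_precomp N hL hL₀ hε hK hK₀ hη _
    (comm_lift (fun i => (hL i).linearMap_comp_eq_zero) hL₀.linearMap_comp_eq_zero hK hK₀ hη f') f'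
    (comm_lift_zero (fun i => (hL i).linearMap_comp_eq_zero) hL₀.linearMap_comp_eq_zero hK hK₀ hη f') n x'

/-- … equivalently `homHComapOfMap … f' (n+1) = E_L ∘ Extⁿ⁺¹(f', N) ∘ E_K⁻¹`.
[cite: Weibel1994, Lemma 2.4.1 (p. 42); Lemma 2.4.4 (p. 43)] -/
theorem homHComapOfMap_eq_extAddEquivHomH_conj (n : ℕ) (y : HomH δ N (n + 1)) :
    homHComapOfMap N (fun i => (hL i).linearMap_comp_eq_zero) hL₀.linearMap_comp_eq_zero hK hK₀ hη f'
        (n + 1) y =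
      extAddEquivHomH N hL hL₀ hε n
        ((Ext.mk₀ (ModuleCat.ofHom f')).comp ((extAddEquivHomH N hK hK₀ hη n).symm y) (zero_add (n + 1))) := by
  rw [extAddEquivHomH_precomp_eq_homHComapOfMap N hL hL₀ hε hK hK₀ hη f', AddEquiv.apply_symm_apply]

end Canonical

section SameModule

variable [Small.{v} R] [∀ i, Module.Projective R (L i)] [∀ i, Module.Projective R (K i)]
  {M : Type v} [AddCommGroup M] [Module R M] {ε : L 0 →ₗ[R] M} {η : K 0 →ₗ[R] M}
  (N : Type v) [AddCommGroup N] [Module R N]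
  (hL : ∀ i, Function.Exact (d (i + 1)) (d i)) (hL₀ : Function.Exact (d 0) ε) (hε : Function.Surjective ε)
  (hK : ∀ i, Function.Exact (δ (i + 1)) (δ i)) (hK₀ : Function.Exact (δ 0) η) (hη : Function.Surjective η)

/-- **A chain map `g• : L• → K•` over `𝟙 M` induces `E_L ∘ E_K⁻¹`**: `homHComap N g hg (n+1) (E_K x) = E_L x` —
«there is a chain map `f : P → Q` lifting the identity map `id_A`, yielding a map `f_*` […] canonical».
[cite: Weibel1994, Lemma 2.4.1 (p. 42)] -/
theorem homHComap_extAddEquivHomH_of_lifts_id {g : ∀ i, L i →ₗ[R] K i} (hg : ∀ i, δ i ∘ₗ g (i + 1) = g i ∘ₗ d i)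
    (hg0 : η ∘ₗ g 0 = ε) (n : ℕ) (x : Ext (ModuleCat.of R M) (ModuleCat.of R N) (n + 1)) :
    homHComap N g hg (n + 1) (extAddEquivHomH N hK hK₀ hη n x) = extAddEquivHomH N hL hL₀ hε n x := by
  rw [← extAddEquivHomH_precomp N hL hL₀ hε hK hK₀ hη g hg LinearMap.id (hg0.trans (LinearMap.id_comp _).symm),
    ModuleCat.ofHom_id, Ext.mk₀_id_comp]

/-- **The explicit comparison of two projective resolutions IS the `Ext`-route comparison**, pointwise: for every
`y ∈ Hⁿ⁺¹(Hom_R(K•, N))`, `homHEquivOfResolutions … (n+1) y = E_L (E_K⁻¹ y) = homHLinearEquivOfResolutions … n y`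
(the tree's two isomorphisms `HomH δ N (n+1) ≃ₗ[R] HomH d N (n+1)` — lit-6 g5's `ModuleResolutionComparison` and
`ExtOfProjectiveResolutionLinearMap` — coincide). [cite: Weibel1994, Lemma 2.4.1 (p. 42); Theorem 2.7.6 (p. 58)] -/
theorem homHEquivOfResolutions_apply_eq (n : ℕ) (y : HomH δ N (n + 1)) :
    homHEquivOfResolutions hL hL₀ hε hK hK₀ hη (n + 1) y =
      homHLinearEquivOfResolutions (N := N) hK hK₀ hη hL hL₀ hε n y := by
  obtain ⟨x, rfl⟩ := (extAddEquivHomH N hK hK₀ hη n).surjective y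
  have hg0 : η ∘ₗ lift d δ ε η (fun i => (hL i).linearMap_comp_eq_zero) hL₀.linearMap_comp_eq_zero hK hK₀ hη
      LinearMap.id 0 = ε :=
    (comm_lift_zero (fun i => (hL i).linearMap_comp_eq_zero) hL₀.linearMap_comp_eq_zero hK hK₀ hη
      LinearMap.id).trans (LinearMap.id_comp _)
  rw [homHEquivOfResolutions_eq_homHComap hL hL₀ hε hK hK₀ hη (n + 1)
      (comm_lift (fun i => (hL i).linearMap_comp_eq_zero) hL₀.linearMap_comp_eq_zero hK hK₀ hη LinearMap.id)
      hg0,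
    homHComap_extAddEquivHomH_of_lifts_id N hL hL₀ hε hK hK₀ hη _ hg0]
  change _ = extLinearEquivHomH hL hL₀ hε n ((extLinearEquivHomH hK hK₀ hη n).symm
    (extLinearEquivHomH hK hK₀ hη n x))
  rw [LinearEquiv.symm_apply_apply]
  rfl

/-- **`homHEquivOfResolutions = homHLinearEquivOfResolutions`** as `R`-linear isomorphisms
`Hⁿ⁺¹(Hom_R(K•, N)) ≃ₗ[R] Hⁿ⁺¹(Hom_R(L•, N))` — closes the `TODO(general form)` of the tree's
`ModuleResolutionComparison` («that they AGREE […] is NOT proved here»).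
[cite: Weibel1994, Lemma 2.4.1 (p. 42); Theorem 2.7.6 (p. 58)] -/
theorem homHEquivOfResolutions_eq_homHLinearEquivOfResolutions (n : ℕ) :
    homHEquivOfResolutions (N := N) hL hL₀ hε hK hK₀ hη (n + 1) =
      homHLinearEquivOfResolutions (N := N) hK hK₀ hη hL hL₀ hε n :=
  LinearEquiv.ext fun y => homHEquivOfResolutions_apply_eq N hL hL₀ hε hK hK₀ hη n y

end SameModule

end ModuleResolution

end Literature.Algebra.Homology
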